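import Summits.QuantumFields.BalabanUV.Beta.D1BFx.RoadEndBFxRecutRaySpineDictS
import Summits.QuantumFields.BalabanUV.Beta.D1BFx.RoadEndBFxDictPointwiseS

/-!
# `BalabanUV.Beta.D1BFx.RoadEndBFxRecutRayDictPointwiseS` — road «BF-x» for binder row D1, PER-WORD lane: the per-word END's ONE (K) row `hdict` IN POINTWISE CURRENCY
# («DICT-PTW-WORD», Ward ray) — the per-word twin of the owner's «DICT-PTW» `RoadEndBFxDictPointwiseS` (p306436)

HONEST DEPENDENCY (page 1, mandatory): continuum YM on T⁴ ⇐ BetaPertH ∧ nine spine estimates (0/9 proved); BetaPertH ⇐ (D1) ∧ (D4) ∧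
CAP+tail; G-an2-4 gates asym, D1 and NE2/3/4.  HONEST FRAMING (cell contract, verbatim): «discharging `BetaPertH` makes Bałaban's UV
stability UNCONDITIONAL — a real constructive-QFT result; it is NOT the continuum limit and NOT the Clay problem.»  THIS MODULE DISCHARGES
NOTHING of the wall: [folklore] composition BY NAME of my per-word junction ENDs `RoadEndBFxRecutRaySpineDictS` (p306406) with the owner's
lane-independent lemma `RoadEndBFxDictPointwiseS.hdict_of_pointwise` (p306436) at the ray letters `cK n := cgh n·n²`, `cQ n := cgh n·a`, `x₀ n := −cgh n`.  No `def`, no `Prop` mirror,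
no cited fact, 0 sorry.  0 root-level binders discharged (hW ∕ hR-sockets ∕ hSX-socket ∕ D1Tel ∕ D1Rep = 0); NOT (K), NOT D1, NOT `BetaPertH`, NOT continuum, NOT Clay.

ABSOLUTE RULE (cell charter, verbatim): «No internally-minted statement may enter as a cited fact. Every hypothesis is either kernel-proved in
this package or a verbatim quotation of a PUBLISHED theorem with page reference. The manuscript(s) under audit are NOT citable for their own
disputed steps — they are the thing under adjudication; programme-internal (2001/route/tribunal) claims are never citable.»

WHY (owner d1-p2 gen 14, [D1P2-G14-ONLINE] ∕ [D1P2-G14-LANDED-1]; leaf-01 g19 «DICT-PTW-MEAN» is the mean-lane twin).  Every dictionary brick in the tree —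
in particular the (A1) identity `KCombineCovStripped.hessKer_transfer_road_cov_stripped` — is an identity of KERNELS, pointwise in the separation `z`;
the owner's `hdict_of_pointwise` reads the (1.22)-moment row `hdict` off ONE pointwise identity per one-shot scale (`hptw`) plus unit-class moment rows on
NAMED rest kernels (`hMR`, `hRu`, `hU₁`), the gluon and ghost terms being well-typed (1.22)-kernels from the END's own rows (`absMoment₂_gluon_of_prop12`,
`absMoment₂_PghQ`).  This file docks that lemma on the per-word lane at the ray: the three per-word ENDs with `hdict` REPLACED IN PLACE by the owner's pointwise rows,
LETTER FOR LETTER, every other binder BYTE-IDENTICAL.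

CONTENT.
* §1 [folklore] **`d1Drift_BFx_recut_ray_of_D1Sum_ptw_sbpS`** — `RoadEndBFxRecutRaySpineDictS.d1Drift_BFx_recut_ray_of_D1Sum_dict_sbpS` with `(hdict)` ↦ `(Rk) {CU'} (hptw) (hMR) (hRu) (hU₁)` ⊢ `D1Drift Lc Js N μ ν`.
* §2 [folklore] **`d1Rep_BFx_recut_ray_of_D1Sum_ptw_sbpS`** — the same over `…of_D1Sum_dict_sbpS` ⊢ `D1Rep Lc Jc N μ ν a SL k`.
* §3 [folklore] **`d1Rep_BFx_recut_ray_of_D1Tel_ptw_sbpS`** — the same over `…of_D1Tel_dict_sbpS` (the spine root's own binder names `hW`∕`hRfl`∕`htel`) ⊢ `D1Rep Lc Jc N μ ν a SL k`.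
Unit `b2b-balaban-beta-d1-formalise-leaf-04` (gen 16), D1 formalisation swarm, per-word lane; journal INTENT 2 [D1LEAF04-G16-X4-INTENT-2]; `LEAVES-BFx.md` row «DICT-PTW-WORD».
-/

noncomputable section

open Finset Filter Topology
open scoped BigOperators
open Literature.MathematicalPhysics.QuantumFieldTheory.Balaban1983to89
open Literature.MathematicalPhysics.QuantumFieldTheory.Balaban1983to89.Beta
open OneStepResolventKernel (JetData)
open OneStepKernelFamily (TbalOf TshotOf flipK D1Tel D1Rep D1Drift)
open PolarizationSign (WardTransversal AxisReflectionCovariant)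
open StepDriftWitness (D1Sum)
open WindowIdentification (fullSum)
open DyadicShell (Pt supNorm)
open ExpKernelCalculus (Site BiLoc shiftK)
open DecimatedMomentSummable (AbsMoment₂)
open BubbleTransfer (unitVec)
open DressedMomentNormalisation (resSite)
open VectorTailsLoc (fam kfam)
open Summit.QuantumFields.BalabanUV.Beta.TameKernelCalculus (Spr)
open Summit.QuantumFields.BalabanUV.Beta.D1BFx.GluonLeg (Ga)
open Summit.QuantumFields.BalabanUV.Beta.D1BFx.ReducedKernel (TableR TOfRed)
open Summit.QuantumFields.BalabanUV.Beta.D1BFx.DressedTadpoleTable (tableRed)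
open Summit.QuantumFields.BalabanUV.Beta.D1BFx.ReducedKernelSandwich (fineHess)
open Summit.QuantumFields.BalabanUV.Beta.D1BFx.FineStencilBFBalaban (SbfBal)
open Summit.QuantumFields.BalabanUV.Beta.D1BFx.SecondStencilBF (Wbf)
open Summit.QuantumFields.BalabanUV.Beta.D1BFx.GhostKernelComplete (PghQ fineHessGhQ)
open Summit.QuantumFields.BalabanUV.Beta.D1BFx.FrozenLegProfile (gfrz)
open Summit.QuantumFields.BalabanUV.Beta.D1BFx.SplitInstance (RestIdx)
open Summit.QuantumFields.BalabanUV.Beta.D1BFx.SplitInstanceS (restKS)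
open Summit.QuantumFields.BalabanUV.Beta.D1BFx.RoadEndBFxRecut (cornerIdx)
open Summit.QuantumFields.BalabanUV.Beta.D1BFx.FrozenLegTails (nOf MOf hn1)
open Summit.QuantumFields.BalabanUV.Beta.D1BFx.RoadEndBFxDictPointwiseS (hdict_of_pointwise)
open Summit.QuantumFields.BalabanUV.Beta.D1BFx.RoadEndBFxRecutRaySpineDictS (d1Drift_BFx_recut_ray_of_D1Sum_dict_sbpS d1Rep_BFx_recut_ray_of_D1Sum_dict_sbpS d1Rep_BFx_recut_ray_of_D1Tel_dict_sbpS)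

namespace Summit.QuantumFields.BalabanUV.Beta.D1BFx.RoadEndBFxRecutRayDictPointwiseS

variable {Lc : ℕ} [NeZero Lc] {a N : ℝ} {μ ν : Fin 4} {υ : Type*} [Fintype υ]
  {cE cVH cΛ cR cK cQ cgh cE₂ cJ4 cΛ₂ cR₂ cQ₂ x₀ ωgl ωgh : ℕ → ℝ} {WE WJ WΛ WR WQ : ℕ → TableR} {CE CJ CΛ CRt CQ δW : ℕ → ℝ}
  {Ru : υ → ℕ → ℝ} {CU : υ → ℝ} {CR : RestIdx → ℝ} {U₁ : ℝ}

/-! ## §1 `D1Drift` over `D1Sum` + the pointwise dictionary rows (per-word END, Ward ray) -/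

/-- [folklore] **ROAD BF-x, PER-WORD END ON THE GHOST WARD RAY `(x₀, cK, cQ) := (−cgh n, cgh n·n², cgh n·a)` OVER `D1Sum`, THE (K) ROW IN POINTWISE CURRENCY.**  `RoadEndBFxRecutRaySpineDictS.d1Drift_BFx_recut_ray_of_D1Sum_dict_sbpS` with its ONE
moment row `hdict` REPLACED by the owner's pointwise rows of `RoadEndBFxDictPointwiseS.hdict_of_pointwise`: rest-word KERNELS `Rk u n`, the pointwise identity
`hptw` (at every one-shot scale `n = Lc^m`, `m ≥ 1`, entry by entry in `z`: the spine's `TshotOf Lc Jc m μ ν z` IS `ωgl n·TOfRed … μ ν z + ωgh n·PghQ … μ ν z + Σ_u Rk u n μ ν z`),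
`hMR` (`AbsMoment₂` of the rest kernels' channel), `hRu` (read-out slack `|M₂[Rk u n] − Ru u n| ≤ CU′ u`), `hU₁` (`Σ_u CU′ u ≤ U₁`).  Every other binder BYTE-IDENTICAL.
Body: ONE call with `hdict_of_pointwise …` in the `hdict` slot.  HONEST: composition BY NAME; `hptw`∕`hMR`∕`hRu`∕`hU₁`, `hsum`, every socket∕row∕`h12`∕`h126` are
HYPOTHESES; 0 root-level binders discharged; (K) NOT closed; NOT D1, NOT `BetaPertH`, NOT continuum, NOT Clay. -/
theorem d1Drift_BFx_recut_ray_of_D1Sum_ptw_sbpS (Js : ℕ → JetData 3 Lc) (hμν : μ ≠ ν) (hN : N ≠ 0) (hL : 2 ≤ Lc) (hodd : Odd Lc) (ha : 0 < a)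
    -- the two PRINTED statements, by name, for the family scale × even cubic volumes
    (h12 : B5.Prop12Printed (fam nOf hn1 MOf a ha)) (h126 : B5.Kernel126_127Printed (kfam nOf MOf))
    -- bridge B1 REPLACED: composite jet data + the telescoping binder; then the ONE dictionary row
    (Jc : ∀ m : ℕ, JetData 3 (Lc ^ m)) (hsum : D1Sum Lc Js Jc μ ν)
    -- THE (K) SLOT IN POINTWISE CURRENCY: rest-word kernels `Rk`, the pointwise dictionary `hptw`, the rest kernels' moments and their read-out slack
    (Rk : υ → ℕ → Fin 4 → Fin 4 → Site 4 → ℝ) {CU' : υ → ℝ}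
    (hptw : ∀ m : ℕ, 1 ≤ m → ∀ z : Site 4, TshotOf Lc Jc m μ ν z =
      ωgl (Lc ^ m) * TOfRed (Lc ^ m) a
          (SbfBal (Lc ^ m) a (cE (Lc ^ m)) (cVH (Lc ^ m)) (cΛ (Lc ^ m)) (cR (Lc ^ m)) (cgh (Lc ^ m) * ((Lc ^ m : ℕ) : ℝ) ^ 2) (cgh (Lc ^ m) * a))
          (tableRed (Lc ^ m) (Wbf (cE₂ (Lc ^ m)) (cJ4 (Lc ^ m)) (cΛ₂ (Lc ^ m)) (cR₂ (Lc ^ m)) (cQ₂ (Lc ^ m))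
            (WE (Lc ^ m)) (WJ (Lc ^ m)) (WΛ (Lc ^ m)) (WR (Lc ^ m)) (WQ (Lc ^ m)))) μ ν z
        + ωgh (Lc ^ m) * PghQ (Lc ^ m) a (-cgh (Lc ^ m)) (cgh (Lc ^ m) * ((Lc ^ m : ℕ) : ℝ) ^ 2) (cgh (Lc ^ m) * a) μ ν z
        + ∑ u, Rk u (Lc ^ m) μ ν z)
    (hMR : ∀ (u : υ) (m : ℕ), 1 ≤ m → AbsMoment₂ (Rk u (Lc ^ m) μ ν))
    (hRu : ∀ (u : υ) (m : ℕ), 1 ≤ m → |B12Beta.secondMoment (Rk u (Lc ^ m)) μ ν - Ru u (Lc ^ m)| ≤ CU' u)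
    (hU₁ : ∑ u, CU' u ≤ U₁)
    (s : ℕ → ℝ) (hωs : ∀ n : ℕ, 2 ≤ n → ωgh n * (s n * (cgh n * (n : ℝ) ^ 2)) ^ 2 = -2 * (ωgl n * cE n ^ 2))
    (hlam : ∀ n : ℕ, 2 ≤ n → ωgl n * cE n ^ 2 = 2 * N ^ 2 * (n : ℝ) ^ 8)
    -- slot-table sockets
    (hδW : ∀ n, 0 < δW n)
    (hE : ∀ n κ u l u', BiLoc (WE n κ u l u') u u' (CE n) (δW n)) (hJ : ∀ n κ u l u', BiLoc (WJ n κ u l u') u u' (CJ n) (δW n))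
    (hΛ : ∀ n κ u l u', BiLoc (WΛ n κ u l u') u u' (CΛ n) (δW n)) (hR : ∀ n κ u l u', BiLoc (WR n κ u l u') u u' (CRt n) (δW n))
    (hQ : ∀ n κ u l u', BiLoc (WQ n κ u l u') u u' (CQ n) (δW n))
    (hEc : ∀ (n : ℕ) (κ : Fin 4) (u : Site 4) (l : Fin 4) (u' t : Site 4),
      WE n κ (u + (n : ℤ) • t) l (u' + (n : ℤ) • t) = shiftK (-((n : ℤ) • t)) (WE n κ u l u'))
    (hJc : ∀ (n : ℕ) (κ : Fin 4) (u : Site 4) (l : Fin 4) (u' t : Site 4),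
      WJ n κ (u + (n : ℤ) • t) l (u' + (n : ℤ) • t) = shiftK (-((n : ℤ) • t)) (WJ n κ u l u'))
    (hΛc : ∀ (n : ℕ) (κ : Fin 4) (u : Site 4) (l : Fin 4) (u' t : Site 4),
      WΛ n κ (u + (n : ℤ) • t) l (u' + (n : ℤ) • t) = shiftK (-((n : ℤ) • t)) (WΛ n κ u l u'))
    (hRc : ∀ (n : ℕ) (κ : Fin 4) (u : Site 4) (l : Fin 4) (u' t : Site 4),
      WR n κ (u + (n : ℤ) • t) l (u' + (n : ℤ) • t) = shiftK (-((n : ℤ) • t)) (WR n κ u l u'))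
    (hQc : ∀ (n : ℕ) (κ : Fin 4) (u : Site 4) (l : Fin 4) (u' t : Site 4),
      WQ n κ (u + (n : ℤ) • t) l (u' + (n : ℤ) • t) = shiftK (-((n : ℤ) • t)) (WQ n κ u l u'))
    (hEs : ∀ n κ u l u', WE n κ u l u' = WE n l u' κ u) (hJs : ∀ n κ u l u', WJ n κ u l u' = WJ n l u' κ u)
    (hΛs : ∀ n κ u l u', WΛ n κ u l u' = WΛ n l u' κ u) (hRs : ∀ n κ u l u', WR n κ u l u' = WR n l u' κ u)
    (hQs : ∀ n κ u l u', WQ n κ u l u' = WQ n l u' κ u)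
    -- first-bond divergence-freeness of the gluon fine Hessian kernel AT THE RAY (the ghost Ward rows are theorems there)
    (hdiv : ∀ n : ℕ, 2 ≤ n → ∀ [NeZero n], ∀ (l' : Fin 4) (u' u : Site 4), ∑ κ' : Fin 4,
      (fineHess n a (SbfBal n a (cE n) (cVH n) (cΛ n) (cR n) (cgh n * (n : ℝ) ^ 2) (cgh n * a))
          (Wbf (cE₂ n) (cJ4 n) (cΛ₂ n) (cR₂ n) (cQ₂ n) (WE n) (WJ n) (WΛ n) (WR n) (WQ n)) κ' l' (u - Pi.single κ' 1) u'
        - fineHess n a (SbfBal n a (cE n) (cVH n) (cΛ n) (cR n) (cgh n * (n : ℝ) ^ 2) (cgh n * a))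
          (Wbf (cE₂ n) (cJ4 n) (cΛ₂ n) (cR₂ n) (cQ₂ n) (WE n) (WJ n) (WΛ n) (WR n) (WQ n)) κ' l' u u') = 0)
    -- (REST′) for the re-cut words other than the corner, n-UNIFORM; (U)
    (hRest : ∀ n : ℕ, 2 ≤ n → ∀ [NeZero n], ∀ τ : RestIdx, τ ≠ cornerIdx →
      |∑ b ∈ (univ : Finset (Fin 4 → Fin n)).image resSite, ((n : ℝ) ^ 4)⁻¹ *
        fullSum (fun w : Pt => restKS n a (gfrz n a b) (fun v => s n * gfrz n a b v) (cE n) (cΛ n) (cR n) (cgh n * (n : ℝ) ^ 2) (cgh n * a) (cE₂ n) (cJ4 n) (cΛ₂ n) (cR₂ n)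
          (cQ₂ n) (-cgh n) (WE n) (WJ n) (WΛ n) (WR n) (WQ n) (ωgl n) (ωgh n) ((n : ℝ) ^ 8) N μ ν b τ w)| ≤ CR τ)
    (hU : ∀ n : ℕ, 2 ≤ n → ∀ u, |Ru u n| ≤ CU u) :
    D1Drift Lc Js N μ ν :=
  d1Drift_BFx_recut_ray_of_D1Sum_dict_sbpS
    Js hμν hN hL hodd ha h12 h126 Jc hsum
    (hdict_of_pointwise (cK := fun n => cgh n * (n : ℝ) ^ 2) (cQ := fun n => cgh n * a) (x₀ := fun n => -cgh n)
      hL ha h12 h126 Jc hδW hE hJ hΛ hR hQ Rk hptw hMR hRu hU₁)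
    s hωs hlam hδW hE hJ hΛ hR hQ hEc hJc hΛc hRc hQc hEs hJs hΛs hRs hQs hdiv hRest hU

/-! ## §2–§3 The per-word road SUPPLIES the spine's `D1Rep` over the pointwise dictionary rows -/

/-- [folklore] **PER-WORD ROAD BF-x ⟹ THE SPINE's `D1Rep`, POINTWISE-DICTIONARY FORM ON THE GHOST WARD RAY `(x₀, cK, cQ) := (−cgh n, cgh n·n², cgh n·a)`** — `RoadEndBFxRecutRaySpineDictS.d1Rep_BFx_recut_ray_of_D1Sum_dict_sbpS` with `(hdict)` ↦
`(Rk) {CU'} (hptw) (hMR) (hRu) (hU₁)`.  HONEST: as §1. -/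
theorem d1Rep_BFx_recut_ray_of_D1Sum_ptw_sbpS (Js : ℕ → JetData 3 Lc) (hμν : μ ≠ ν) (hN : N ≠ 0) (hL : 2 ≤ Lc) (hodd : Odd Lc) (ha : 0 < a)
    -- the two PRINTED statements, by name, for the family scale × even cubic volumes
    (h12 : B5.Prop12Printed (fam nOf hn1 MOf a ha)) (h126 : B5.Kernel126_127Printed (kfam nOf MOf))
    -- bridge B1 REPLACED: composite jet data + the telescoping binder; then the ONE dictionary row
    (Jc : ∀ m : ℕ, JetData 3 (Lc ^ m)) (hsum : D1Sum Lc Js Jc μ ν)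
    -- THE (K) SLOT IN POINTWISE CURRENCY: rest-word kernels `Rk`, the pointwise dictionary `hptw`, the rest kernels' moments and their read-out slack
    (Rk : υ → ℕ → Fin 4 → Fin 4 → Site 4 → ℝ) {CU' : υ → ℝ}
    (hptw : ∀ m : ℕ, 1 ≤ m → ∀ z : Site 4, TshotOf Lc Jc m μ ν z =
      ωgl (Lc ^ m) * TOfRed (Lc ^ m) a
          (SbfBal (Lc ^ m) a (cE (Lc ^ m)) (cVH (Lc ^ m)) (cΛ (Lc ^ m)) (cR (Lc ^ m)) (cgh (Lc ^ m) * ((Lc ^ m : ℕ) : ℝ) ^ 2) (cgh (Lc ^ m) * a))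
          (tableRed (Lc ^ m) (Wbf (cE₂ (Lc ^ m)) (cJ4 (Lc ^ m)) (cΛ₂ (Lc ^ m)) (cR₂ (Lc ^ m)) (cQ₂ (Lc ^ m))
            (WE (Lc ^ m)) (WJ (Lc ^ m)) (WΛ (Lc ^ m)) (WR (Lc ^ m)) (WQ (Lc ^ m)))) μ ν z
        + ωgh (Lc ^ m) * PghQ (Lc ^ m) a (-cgh (Lc ^ m)) (cgh (Lc ^ m) * ((Lc ^ m : ℕ) : ℝ) ^ 2) (cgh (Lc ^ m) * a) μ ν z
        + ∑ u, Rk u (Lc ^ m) μ ν z)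
    (hMR : ∀ (u : υ) (m : ℕ), 1 ≤ m → AbsMoment₂ (Rk u (Lc ^ m) μ ν))
    (hRu : ∀ (u : υ) (m : ℕ), 1 ≤ m → |B12Beta.secondMoment (Rk u (Lc ^ m)) μ ν - Ru u (Lc ^ m)| ≤ CU' u)
    (hU₁ : ∑ u, CU' u ≤ U₁)
    (s : ℕ → ℝ) (hωs : ∀ n : ℕ, 2 ≤ n → ωgh n * (s n * (cgh n * (n : ℝ) ^ 2)) ^ 2 = -2 * (ωgl n * cE n ^ 2))
    (hlam : ∀ n : ℕ, 2 ≤ n → ωgl n * cE n ^ 2 = 2 * N ^ 2 * (n : ℝ) ^ 8)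
    -- slot-table sockets
    (hδW : ∀ n, 0 < δW n)
    (hE : ∀ n κ u l u', BiLoc (WE n κ u l u') u u' (CE n) (δW n)) (hJ : ∀ n κ u l u', BiLoc (WJ n κ u l u') u u' (CJ n) (δW n))
    (hΛ : ∀ n κ u l u', BiLoc (WΛ n κ u l u') u u' (CΛ n) (δW n)) (hR : ∀ n κ u l u', BiLoc (WR n κ u l u') u u' (CRt n) (δW n))
    (hQ : ∀ n κ u l u', BiLoc (WQ n κ u l u') u u' (CQ n) (δW n))
    (hEc : ∀ (n : ℕ) (κ : Fin 4) (u : Site 4) (l : Fin 4) (u' t : Site 4),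
      WE n κ (u + (n : ℤ) • t) l (u' + (n : ℤ) • t) = shiftK (-((n : ℤ) • t)) (WE n κ u l u'))
    (hJc : ∀ (n : ℕ) (κ : Fin 4) (u : Site 4) (l : Fin 4) (u' t : Site 4),
      WJ n κ (u + (n : ℤ) • t) l (u' + (n : ℤ) • t) = shiftK (-((n : ℤ) • t)) (WJ n κ u l u'))
    (hΛc : ∀ (n : ℕ) (κ : Fin 4) (u : Site 4) (l : Fin 4) (u' t : Site 4),
      WΛ n κ (u + (n : ℤ) • t) l (u' + (n : ℤ) • t) = shiftK (-((n : ℤ) • t)) (WΛ n κ u l u'))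
    (hRc : ∀ (n : ℕ) (κ : Fin 4) (u : Site 4) (l : Fin 4) (u' t : Site 4),
      WR n κ (u + (n : ℤ) • t) l (u' + (n : ℤ) • t) = shiftK (-((n : ℤ) • t)) (WR n κ u l u'))
    (hQc : ∀ (n : ℕ) (κ : Fin 4) (u : Site 4) (l : Fin 4) (u' t : Site 4),
      WQ n κ (u + (n : ℤ) • t) l (u' + (n : ℤ) • t) = shiftK (-((n : ℤ) • t)) (WQ n κ u l u'))
    (hEs : ∀ n κ u l u', WE n κ u l u' = WE n l u' κ u) (hJs : ∀ n κ u l u', WJ n κ u l u' = WJ n l u' κ u)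
    (hΛs : ∀ n κ u l u', WΛ n κ u l u' = WΛ n l u' κ u) (hRs : ∀ n κ u l u', WR n κ u l u' = WR n l u' κ u)
    (hQs : ∀ n κ u l u', WQ n κ u l u' = WQ n l u' κ u)
    -- first-bond divergence-freeness of the gluon fine Hessian kernel AT THE RAY (the ghost Ward rows are theorems there)
    (hdiv : ∀ n : ℕ, 2 ≤ n → ∀ [NeZero n], ∀ (l' : Fin 4) (u' u : Site 4), ∑ κ' : Fin 4,
      (fineHess n a (SbfBal n a (cE n) (cVH n) (cΛ n) (cR n) (cgh n * (n : ℝ) ^ 2) (cgh n * a))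
          (Wbf (cE₂ n) (cJ4 n) (cΛ₂ n) (cR₂ n) (cQ₂ n) (WE n) (WJ n) (WΛ n) (WR n) (WQ n)) κ' l' (u - Pi.single κ' 1) u'
        - fineHess n a (SbfBal n a (cE n) (cVH n) (cΛ n) (cR n) (cgh n * (n : ℝ) ^ 2) (cgh n * a))
          (Wbf (cE₂ n) (cJ4 n) (cΛ₂ n) (cR₂ n) (cQ₂ n) (WE n) (WJ n) (WΛ n) (WR n) (WQ n)) κ' l' u u') = 0)
    -- (REST′) for the re-cut words other than the corner, n-UNIFORM; (U)
    (hRest : ∀ n : ℕ, 2 ≤ n → ∀ [NeZero n], ∀ τ : RestIdx, τ ≠ cornerIdx →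
      |∑ b ∈ (univ : Finset (Fin 4 → Fin n)).image resSite, ((n : ℝ) ^ 4)⁻¹ *
        fullSum (fun w : Pt => restKS n a (gfrz n a b) (fun v => s n * gfrz n a b v) (cE n) (cΛ n) (cR n) (cgh n * (n : ℝ) ^ 2) (cgh n * a) (cE₂ n) (cJ4 n) (cΛ₂ n) (cR₂ n)
          (cQ₂ n) (-cgh n) (WE n) (WJ n) (WΛ n) (WR n) (WQ n) (ωgl n) (ωgh n) ((n : ℝ) ^ 8) N μ ν b τ w)| ≤ CR τ)
    (hU : ∀ n : ℕ, 2 ≤ n → ∀ u, |Ru u n| ≤ CU u)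
    -- base-point labels of the free one-shot side (the spine root's `hSL` ∕ `k`); the Literature's window data is discharged at `M := id`, `cc := 1`
    {L : Type*} {SL : Finset L} (hSL : SL.Nonempty) (k : L → Fin 4) :
    D1Rep Lc Jc N μ ν a SL k :=
  d1Rep_BFx_recut_ray_of_D1Sum_dict_sbpS
    Js hμν hN hL hodd ha h12 h126 Jc hsum
    (hdict_of_pointwise (cK := fun n => cgh n * (n : ℝ) ^ 2) (cQ := fun n => cgh n * a) (x₀ := fun n => -cgh n)
      hL ha h12 h126 Jc hδW hE hJ hΛ hR hQ Rk hptw hMR hRu hU₁)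
    s hωs hlam hδW hE hJ hΛ hR hQ hEc hJc hΛc hRc hQc hEs hJs hΛs hRs hQs hdiv hRest hU hSL k

/-- [folklore] **PER-WORD ROAD BF-x ⟹ THE SPINE's `D1Rep` AT THE SPINE ROOT's OWN BINDER NAMES, POINTWISE-DICTIONARY FORM ON THE GHOST WARD RAY `(x₀, cK, cQ) := (−cgh n, cgh n·n², cgh n·a)`** —
`RoadEndBFxRecutRaySpineDictS.d1Rep_BFx_recut_ray_of_D1Tel_dict_sbpS` with `(hdict)` ↦ `(Rk) {CU'} (hptw) (hMR) (hRu) (hU₁)`; telescoping displayed as `hW`∕`hRfl`∕`htel : D1Tel Lc Js Jc`.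
READING: the per-word road's END for the spine root now displays, about Bałaban's kernels, ONE POINTWISE IDENTITY per one-shot scale (`hptw`) + unit-class
moment rows on named rest kernels — the currency of (A1) `KCombineCovStripped.hessKer_transfer_road_cov_stripped`.  HONEST: as §1. -/
theorem d1Rep_BFx_recut_ray_of_D1Tel_ptw_sbpS (Js : ℕ → JetData 3 Lc) (hμν : μ ≠ ν) (hN : N ≠ 0) (hL : 2 ≤ Lc) (hodd : Odd Lc) (ha : 0 < a)
    -- the two PRINTED statements, by name, for the family scale × even cubic volumes
    (h12 : B5.Prop12Printed (fam nOf hn1 MOf a ha)) (h126 : B5.Kernel126_127Printed (kfam nOf MOf))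
    -- bridge B1 REPLACED: composite jet data + the telescoping binder; then the ONE dictionary row
    (Jc : ∀ m : ℕ, JetData 3 (Lc ^ m)) 
    (hW : ∀ j, WardTransversal (flipK (TbalOf Lc Js j))) (hRfl : ∀ j, AxisReflectionCovariant (flipK (TbalOf Lc Js j)))
    (htel : D1Tel Lc Js Jc)
    -- THE (K) SLOT IN POINTWISE CURRENCY: rest-word kernels `Rk`, the pointwise dictionary `hptw`, the rest kernels' moments and their read-out slack
    (Rk : υ → ℕ → Fin 4 → Fin 4 → Site 4 → ℝ) {CU' : υ → ℝ}
    (hptw : ∀ m : ℕ, 1 ≤ m → ∀ z : Site 4, TshotOf Lc Jc m μ ν z =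
      ωgl (Lc ^ m) * TOfRed (Lc ^ m) a
          (SbfBal (Lc ^ m) a (cE (Lc ^ m)) (cVH (Lc ^ m)) (cΛ (Lc ^ m)) (cR (Lc ^ m)) (cgh (Lc ^ m) * ((Lc ^ m : ℕ) : ℝ) ^ 2) (cgh (Lc ^ m) * a))
          (tableRed (Lc ^ m) (Wbf (cE₂ (Lc ^ m)) (cJ4 (Lc ^ m)) (cΛ₂ (Lc ^ m)) (cR₂ (Lc ^ m)) (cQ₂ (Lc ^ m))
            (WE (Lc ^ m)) (WJ (Lc ^ m)) (WΛ (Lc ^ m)) (WR (Lc ^ m)) (WQ (Lc ^ m)))) μ ν z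
        + ωgh (Lc ^ m) * PghQ (Lc ^ m) a (-cgh (Lc ^ m)) (cgh (Lc ^ m) * ((Lc ^ m : ℕ) : ℝ) ^ 2) (cgh (Lc ^ m) * a) μ ν z
        + ∑ u, Rk u (Lc ^ m) μ ν z)
    (hMR : ∀ (u : υ) (m : ℕ), 1 ≤ m → AbsMoment₂ (Rk u (Lc ^ m) μ ν))
    (hRu : ∀ (u : υ) (m : ℕ), 1 ≤ m → |B12Beta.secondMoment (Rk u (Lc ^ m)) μ ν - Ru u (Lc ^ m)| ≤ CU' u)
    (hU₁ : ∑ u, CU' u ≤ U₁)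
    (s : ℕ → ℝ) (hωs : ∀ n : ℕ, 2 ≤ n → ωgh n * (s n * (cgh n * (n : ℝ) ^ 2)) ^ 2 = -2 * (ωgl n * cE n ^ 2))
    (hlam : ∀ n : ℕ, 2 ≤ n → ωgl n * cE n ^ 2 = 2 * N ^ 2 * (n : ℝ) ^ 8)
    -- slot-table sockets
    (hδW : ∀ n, 0 < δW n)
    (hE : ∀ n κ u l u', BiLoc (WE n κ u l u') u u' (CE n) (δW n)) (hJ : ∀ n κ u l u', BiLoc (WJ n κ u l u') u u' (CJ n) (δW n))
    (hΛ : ∀ n κ u l u', BiLoc (WΛ n κ u l u') u u' (CΛ n) (δW n)) (hR : ∀ n κ u l u', BiLoc (WR n κ u l u') u u' (CRt n) (δW n))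
    (hQ : ∀ n κ u l u', BiLoc (WQ n κ u l u') u u' (CQ n) (δW n))
    (hEc : ∀ (n : ℕ) (κ : Fin 4) (u : Site 4) (l : Fin 4) (u' t : Site 4),
      WE n κ (u + (n : ℤ) • t) l (u' + (n : ℤ) • t) = shiftK (-((n : ℤ) • t)) (WE n κ u l u'))
    (hJc : ∀ (n : ℕ) (κ : Fin 4) (u : Site 4) (l : Fin 4) (u' t : Site 4),
      WJ n κ (u + (n : ℤ) • t) l (u' + (n : ℤ) • t) = shiftK (-((n : ℤ) • t)) (WJ n κ u l u'))
    (hΛc : ∀ (n : ℕ) (κ : Fin 4) (u : Site 4) (l : Fin 4) (u' t : Site 4),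
      WΛ n κ (u + (n : ℤ) • t) l (u' + (n : ℤ) • t) = shiftK (-((n : ℤ) • t)) (WΛ n κ u l u'))
    (hRc : ∀ (n : ℕ) (κ : Fin 4) (u : Site 4) (l : Fin 4) (u' t : Site 4),
      WR n κ (u + (n : ℤ) • t) l (u' + (n : ℤ) • t) = shiftK (-((n : ℤ) • t)) (WR n κ u l u'))
    (hQc : ∀ (n : ℕ) (κ : Fin 4) (u : Site 4) (l : Fin 4) (u' t : Site 4),
      WQ n κ (u + (n : ℤ) • t) l (u' + (n : ℤ) • t) = shiftK (-((n : ℤ) • t)) (WQ n κ u l u'))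
    (hEs : ∀ n κ u l u', WE n κ u l u' = WE n l u' κ u) (hJs : ∀ n κ u l u', WJ n κ u l u' = WJ n l u' κ u)
    (hΛs : ∀ n κ u l u', WΛ n κ u l u' = WΛ n l u' κ u) (hRs : ∀ n κ u l u', WR n κ u l u' = WR n l u' κ u)
    (hQs : ∀ n κ u l u', WQ n κ u l u' = WQ n l u' κ u)
    -- first-bond divergence-freeness of the gluon fine Hessian kernel AT THE RAY (the ghost Ward rows are theorems there)
    (hdiv : ∀ n : ℕ, 2 ≤ n → ∀ [NeZero n], ∀ (l' : Fin 4) (u' u : Site 4), ∑ κ' : Fin 4,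
      (fineHess n a (SbfBal n a (cE n) (cVH n) (cΛ n) (cR n) (cgh n * (n : ℝ) ^ 2) (cgh n * a))
          (Wbf (cE₂ n) (cJ4 n) (cΛ₂ n) (cR₂ n) (cQ₂ n) (WE n) (WJ n) (WΛ n) (WR n) (WQ n)) κ' l' (u - Pi.single κ' 1) u'
        - fineHess n a (SbfBal n a (cE n) (cVH n) (cΛ n) (cR n) (cgh n * (n : ℝ) ^ 2) (cgh n * a))
          (Wbf (cE₂ n) (cJ4 n) (cΛ₂ n) (cR₂ n) (cQ₂ n) (WE n) (WJ n) (WΛ n) (WR n) (WQ n)) κ' l' u u') = 0)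
    -- (REST′) for the re-cut words other than the corner, n-UNIFORM; (U)
    (hRest : ∀ n : ℕ, 2 ≤ n → ∀ [NeZero n], ∀ τ : RestIdx, τ ≠ cornerIdx →
      |∑ b ∈ (univ : Finset (Fin 4 → Fin n)).image resSite, ((n : ℝ) ^ 4)⁻¹ *
        fullSum (fun w : Pt => restKS n a (gfrz n a b) (fun v => s n * gfrz n a b v) (cE n) (cΛ n) (cR n) (cgh n * (n : ℝ) ^ 2) (cgh n * a) (cE₂ n) (cJ4 n) (cΛ₂ n) (cR₂ n)
          (cQ₂ n) (-cgh n) (WE n) (WJ n) (WΛ n) (WR n) (WQ n) (ωgl n) (ωgh n) ((n : ℝ) ^ 8) N μ ν b τ w)| ≤ CR τ)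
    (hU : ∀ n : ℕ, 2 ≤ n → ∀ u, |Ru u n| ≤ CU u)
    -- base-point labels of the free one-shot side (the spine root's `hSL` ∕ `k`); the Literature's window data is discharged at `M := id`, `cc := 1`
    {L : Type*} {SL : Finset L} (hSL : SL.Nonempty) (k : L → Fin 4) :
    D1Rep Lc Jc N μ ν a SL k :=
  d1Rep_BFx_recut_ray_of_D1Tel_dict_sbpS
    Js hμν hN hL hodd ha h12 h126 Jc hW hRfl htel
    (hdict_of_pointwise (cK := fun n => cgh n * (n : ℝ) ^ 2) (cQ := fun n => cgh n * a) (x₀ := fun n => -cgh n)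
      hL ha h12 h126 Jc hδW hE hJ hΛ hR hQ Rk hptw hMR hRu hU₁)
    s hωs hlam hδW hE hJ hΛ hR hQ hEc hJc hΛc hRc hQc hEs hJs hΛs hRs hQs hdiv hRest hU hSL k

end Summit.QuantumFields.BalabanUV.Beta.D1BFx.RoadEndBFxRecutRayDictPointwiseS

end
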